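import Mathlib
import Summits.ValiantsHypothesis.ValiantsHypothesis.Theorems.RigidityForcesSymmetryRankRigidMinimalReprLaplaceFiveSeparatedCaptureLinesK1
import Summits.ValiantsHypothesis.ValiantsHypothesis.Theorems.RigidityForcesSymmetryRankRigidMinimalReprLaplaceFiveSeparatedCaptureTwoLines

/-!
# ValiantsHypothesis / RigidityForcesSymmetry — crux `LaplaceOptimalFive` (stmt-ValiantsHypothesis-24813), young-shadow K1:
# **K1 ON `K₃ ⊔ K₂` FOR THE `(1,1,≤2)` FAMILY** — two triangle cuts with at most one short-factor direction, the third with at most two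

K1 consumer of ✓ `captureIneqSym_of_two_lines` (val-port-2 g5: the `(1,1,≤2)` family of the symmetric capture inequality) through the
local bridge ✓ `sideSym_K32canon_of_captureAt` (`…K1Bridge.lean`), in the shape of ✓ `sideSym_K32canon_lines` (`…LinesK1.lean`):
a side-symmetric split decomposition of `P₅` on `{01, 02, 12, 34}` with `dim shortSpan ≤ 1, ≤ 1, ≤ 2` on the cuts `{0,1}, {0,2}, {1,2}`
(in any of the three placements of the wide cut — rôle symmetry ✓ `contractZ_mem_L3_swap13/23`) has Laplace weight `≥ 5! = 120`.
An empty narrow cut is dispatched by ✓ `captureIneqSym_of_one_bot`; two nonzero lines by ✓ `captureIneqSym_of_two_lines`.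

* ★★ `sideSym_K32canon_two_lines` — wide cut `{1,2}`;  ★ `…_wide01`, ★ `…_wide02` — the other two placements.

Honest framing.  A SUB-CASE of K1 on `K₃ ⊔ K₂` (it contains ✓ `sideSym_K32canon_lines` and ✓ `sideSym_K32canon_equalLines`); K1 on
`K₃ ⊔ K₂` in general, `CaptureIneqSym`, S2′, `LaplaceOptimalFive` (OPEN · CONTESTED 72/120), `RankRigidMinimalRepr`, `VP ≠ VNP` are NOT
proved.  No definitions, no `sorry`.
-/

set_option linter.dupNamespace false
set_option autoImplicit false

namespace Summit.ValiantsHypothesis.ValiantsHypothesis.Theorems.RigidityForcesSymmetryRankRigidMinimalRepr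

namespace LaplaceFiveSeparatedCapture

open Finset LaplaceFiveSectorSplit

/-! ### K1 on `K₃ ⊔ K₂` for two line-cuts and a third cut of dimension `≤ 2` -/

/-- ★★ **K1 ON `K₃ ⊔ K₂` FOR «TWO TRIANGLE CUTS WITH ≤ 1 DIRECTION, THE THIRD WITH ≤ 2» — UNCONDITIONAL.**  A side-symmetric split
decomposition of `P₅` on `{01, 02, 12, 34}` whose short spans on the cuts `{0,1}` and `{0,2}` have dimension `≤ 1` and whose short span on
`{1,2}` has dimension `≤ 2` (leaf factors and long factors arbitrary) has Laplace weight `≥ 5! = 120`: the local bridge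
✓ `sideSym_K32canon_of_captureAt` fed by ✓ `captureIneqSym_of_two_lines` (both lines nonzero) or by ✓ `captureIneqSym_of_one_bot`
(an empty cut). [folklore] -/
theorem sideSym_K32canon_two_lines {N : ℕ} (T : Finset (Fin N)) (S : Fin N → Finset (Fin 5))
    (u w : Fin N → (Fin 5 → Fin 5) → ℂ) (hdec : IsSplitDecomposition T S u w) (hsym : SideSymmetric T S u w)
    (hC : ∀ t ∈ T, S t = ({0, 1} : Finset (Fin 5)) ∨ S t = ({0, 2} : Finset (Fin 5)) ∨
      S t = ({1, 2} : Finset (Fin 5)) ∨ S t = ({3, 4} : Finset (Fin 5)))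
    (h01 : Module.finrank ℂ (shortSpan T S u 0 1) ≤ 1) (h02 : Module.finrank ℂ (shortSpan T S u 0 2) ≤ 1)
    (h12 : Module.finrank ℂ (shortSpan T S u 1 2) ≤ 2) :
    Nat.factorial 5 ≤ laplaceWeight T S := by
  refine sideSym_K32canon_of_captureAt T S u w hdec hsym hC fun hs01 hs02 hs12 W hWs hWd hWc => ?_
  rcases eq_bot_or_line_of_finrank_le_one _ h01 with hb1 | ⟨u₁, hn₁, -, he₁⟩
  · exact captureIneqSym_of_one_bot _ _ _ W hs01 hs02 hs12 (Or.inl hb1) hWs hWd hWc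
  rcases eq_bot_or_line_of_finrank_le_one _ h02 with hb2 | ⟨u₂, hn₂, -, he₂⟩
  · exact captureIneqSym_of_one_bot _ _ _ W hs01 hs02 hs12 (Or.inr (Or.inl hb2)) hWs hWd hWc
  have hu₁ : ∀ p q, u₁ p q = u₁ q p := fun p q => hs01 u₁ (by rw [he₁]; exact Submodule.mem_span_singleton_self u₁) p q
  have hu₂ : ∀ p q, u₂ p q = u₂ q p := fun p q => hs02 u₂ (by rw [he₂]; exact Submodule.mem_span_singleton_self u₂) p q
  have h := captureIneqSym_of_two_lines u₁ u₂ hu₁ hu₂ hn₁ hn₂ (shortSpan T S u 1 2) W hs12 h12 hWs hWd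
    (fun μ hμ => by rw [← he₁, ← he₂]; exact hWc μ hμ)
  rw [← he₁, ← he₂] at h
  exact h

/-- ★ **The same with the wide cut at `{0,1}`** (rôle symmetry of `L₃`, ✓ `contractZ_mem_L3_swap13`): short spans of dimension
`≤ 2, ≤ 1, ≤ 1` on the cuts `{0,1}, {0,2}, {1,2}`. [folklore] -/
theorem sideSym_K32canon_two_lines_wide01 {N : ℕ} (T : Finset (Fin N)) (S : Fin N → Finset (Fin 5))
    (u w : Fin N → (Fin 5 → Fin 5) → ℂ) (hdec : IsSplitDecomposition T S u w) (hsym : SideSymmetric T S u w)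
    (hC : ∀ t ∈ T, S t = ({0, 1} : Finset (Fin 5)) ∨ S t = ({0, 2} : Finset (Fin 5)) ∨
      S t = ({1, 2} : Finset (Fin 5)) ∨ S t = ({3, 4} : Finset (Fin 5)))
    (h01 : Module.finrank ℂ (shortSpan T S u 0 1) ≤ 2) (h02 : Module.finrank ℂ (shortSpan T S u 0 2) ≤ 1)
    (h12 : Module.finrank ℂ (shortSpan T S u 1 2) ≤ 1) :
    Nat.factorial 5 ≤ laplaceWeight T S := by
  refine sideSym_K32canon_of_captureAt T S u w hdec hsym hC fun hs01 hs02 hs12 W hWs hWd hWc => ?_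
  -- read the capture with the rôles of the cuts `{0,1}` and `{1,2}` exchanged
  have hWc' : ∀ μ ∈ W, contractZ μ ∈ L3 (shortSpan T S u 1 2) (shortSpan T S u 0 2) (shortSpan T S u 0 1) :=
    fun μ hμ => contractZ_mem_L3_swap13 _ _ _ hs01 hs02 hs12 μ (hWc μ hμ)
  rcases eq_bot_or_line_of_finrank_le_one _ h12 with hb1 | ⟨u₁, hn₁, -, he₁⟩
  · have h := captureIneqSym_of_one_bot _ _ _ W hs12 hs02 hs01 (Or.inl hb1) hWs hWd hWc'
    omega
  rcases eq_bot_or_line_of_finrank_le_one _ h02 with hb2 | ⟨u₂, hn₂, -, he₂⟩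
  · have h := captureIneqSym_of_one_bot _ _ _ W hs12 hs02 hs01 (Or.inr (Or.inl hb2)) hWs hWd hWc'
    omega
  have hu₁ : ∀ p q, u₁ p q = u₁ q p := fun p q => hs12 u₁ (by rw [he₁]; exact Submodule.mem_span_singleton_self u₁) p q
  have hu₂ : ∀ p q, u₂ p q = u₂ q p := fun p q => hs02 u₂ (by rw [he₂]; exact Submodule.mem_span_singleton_self u₂) p q
  have h := captureIneqSym_of_two_lines u₁ u₂ hu₁ hu₂ hn₁ hn₂ (shortSpan T S u 0 1) W hs01 h01 hWs hWd
    (fun μ hμ => by rw [← he₁, ← he₂]; exact hWc' μ hμ)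
  rw [← he₁, ← he₂] at h
  omega

/-- ★ **The same with the wide cut at `{0,2}`** (✓ `contractZ_mem_L3_swap23`): dimensions `≤ 1, ≤ 2, ≤ 1`. [folklore] -/
theorem sideSym_K32canon_two_lines_wide02 {N : ℕ} (T : Finset (Fin N)) (S : Fin N → Finset (Fin 5))
    (u w : Fin N → (Fin 5 → Fin 5) → ℂ) (hdec : IsSplitDecomposition T S u w) (hsym : SideSymmetric T S u w)
    (hC : ∀ t ∈ T, S t = ({0, 1} : Finset (Fin 5)) ∨ S t = ({0, 2} : Finset (Fin 5)) ∨
      S t = ({1, 2} : Finset (Fin 5)) ∨ S t = ({3, 4} : Finset (Fin 5)))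
    (h01 : Module.finrank ℂ (shortSpan T S u 0 1) ≤ 1) (h02 : Module.finrank ℂ (shortSpan T S u 0 2) ≤ 2)
    (h12 : Module.finrank ℂ (shortSpan T S u 1 2) ≤ 1) :
    Nat.factorial 5 ≤ laplaceWeight T S := by
  refine sideSym_K32canon_of_captureAt T S u w hdec hsym hC fun hs01 hs02 hs12 W hWs hWd hWc => ?_
  -- exchange the rôles of the cuts `{0,2}` and `{1,2}`
  have hWc' : ∀ μ ∈ W, contractZ μ ∈ L3 (shortSpan T S u 0 1) (shortSpan T S u 1 2) (shortSpan T S u 0 2) :=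
    fun μ hμ => contractZ_mem_L3_swap23 _ _ _ hs01 μ (hWc μ hμ)
  rcases eq_bot_or_line_of_finrank_le_one _ h01 with hb1 | ⟨u₁, hn₁, -, he₁⟩
  · have h := captureIneqSym_of_one_bot _ _ _ W hs01 hs12 hs02 (Or.inl hb1) hWs hWd hWc'
    omega
  rcases eq_bot_or_line_of_finrank_le_one _ h12 with hb2 | ⟨u₂, hn₂, -, he₂⟩
  · have h := captureIneqSym_of_one_bot _ _ _ W hs01 hs12 hs02 (Or.inr (Or.inl hb2)) hWs hWd hWc'
    omega
  have hu₁ : ∀ p q, u₁ p q = u₁ q p := fun p q => hs01 u₁ (by rw [he₁]; exact Submodule.mem_span_singleton_self u₁) p q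
  have hu₂ : ∀ p q, u₂ p q = u₂ q p := fun p q => hs12 u₂ (by rw [he₂]; exact Submodule.mem_span_singleton_self u₂) p q
  have h := captureIneqSym_of_two_lines u₁ u₂ hu₁ hu₂ hn₁ hn₂ (shortSpan T S u 0 2) W hs02 h02 hWs hWd
    (fun μ hμ => by rw [← he₁, ← he₂]; exact hWc' μ hμ)
  rw [← he₁, ← he₂] at h
  omega

end LaplaceFiveSeparatedCapture

end Summit.ValiantsHypothesis.ValiantsHypothesis.Theorems.RigidityForcesSymmetryRankRigidMinimalRepr
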